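import Mathlib
import Summits.Parity.GeneralizedHardyLittlewood.Theses.LiouvilleMAD
import Summits.Parity.GeneralizedHardyLittlewood.Theorems.LiouvilleMADFanDecorrelationStubResidueSplitting

/-!
# The open stubs of line `SketchIdeator1` sandwich the crux `FanDecorrelation` (circularity)

Crux `FanDecorrelation` (`Summit.Parity.GeneralizedHardyLittlewood.Theses.LiouvilleMAD`,
stmt-Parity-13318), line `SketchIdeator1` (idea `lag-window-normal-form`).  Notation (informal;
nothing is defined here, every statement is written out over Mathlib): `Q = ⌊√M⌋ + 1`,
`λ = ArithmeticFunction.liouville`, fan sum `R_k = Σ_{j ∈ [Q,2Q)} Σ_{(m,m') ∈ (M,2M]², m − m' = kj}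
λ(mn+c) λ(m'n'+c)`, unit fan of class `r < k`:
`U_r(k) = Σ_{(y,y') ∈ ((M−r)/k,(2M−r)/k]², y − y' ∈ [Q,2Q)} λ((ky+r)n+c) λ((ky'+r)n'+c)`.

The line's skeleton (`Cruxes/FanDecorrelation/Lines/SketchIdeator1.lean`) closes the crux from two
open stubs — the LAG-WINDOW LAW at `δ` (`|U_r(k)| ≤ C·M^{1−κ}/k` for `1 ≤ k ≤ M^{1/2−δ}`, `r < k`)
and the FAN-WINDOW COSET LAW at `δ` (`|Σ_{r<q} U_r(q)| ≤ C·M^{3/4+ϑ}` for `M^{1/2−δ} ≤ q < 2Q`) —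
via the landed transfer `FanFromLaws.stub_fanFromLaws` (p96381) and the landed residue splitting
`ResidueSplitting.stub_residueSplitting` (`R_k = Σ_{r<k} U_r(k)` for `1 ≤ k ≤ M`, p96332).

This file records, kernel-checked, that the two open stubs CONTAIN the crux, so that the line has
no content separable from the crux itself:

* `fanWindowCosetLaw_of_fanDecorrelation`: for EVERY `δ`, `FanDecorrelation` implies the fan-window
  coset law at `δ` with the same exponent `ϑ` (residue splitting read backwards with `k = q`; the
  degenerate moduli `q = 0` and `q > M` give empty sums).  So stub 3 is EQUIVALENT to the crux
  restricted to the moduli `k = q ∈ [M^{1/2−δ}, 2Q)`.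
* `fanDecorrelation_one_of_lagWindowLaw`: for every `δ ≤ 1/2`, the lag-window law at `δ` implies
  the crux at `k = 1` with `ϑ = 1/4 − κ` (its instance `(k, r) = (1, 0)` IS `R_1`, by residue
  splitting at `k = 1`).  So stub 2 contains the `k = 1` case of the crux verbatim — the case both
  crux-idea cards identify as the whole difficulty ("second-order Chowla": signed, power-saving,
  shift-averaged two-point Liouville correlations over a window of `√M` consecutive lags).

Pure bookkeeping over Mathlib and the landed residue splitting; no analytic input.
-/

namespace Summit.Parity.GeneralizedHardyLittlewood.Theorems.FanDecorrelation.Circularity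

open ArithmeticFunction
open Summit.Parity.GeneralizedHardyLittlewood.Theses.LiouvilleMAD

/-- For a modulus `q > M` the class-summed unit fan is an empty sum: every class box
`((M−r)/q, (2M−r)/q]` is contained in `{1}` (as `2M − r < 2q`), so `y − y' ≤ 0 < Q` and the lag
window `[Q, 2Q)` is never met. [folklore] -/
theorem classSum_eq_zero_of_lt (c : ℤ) (n n' M q : ℕ) (hq : M < q) :
    (∑ r ∈ Finset.range q,
      ∑ p ∈ (Finset.Ioc ((M - r) / q) ((2 * M - r) / q) ×ˢ
              Finset.Ioc ((M - r) / q) ((2 * M - r) / q)).filter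
          (fun p : ℕ × ℕ => (Nat.sqrt M : ℤ) + 1 ≤ (p.1 : ℤ) - p.2 ∧
            (p.1 : ℤ) - p.2 < 2 * ((Nat.sqrt M : ℤ) + 1)),
        (liouville (Int.toNat (((q : ℤ) * p.1 + r) * n + c)) : ℝ) *
          (liouville (Int.toNat (((q : ℤ) * p.2 + r) * n' + c)) : ℝ)) = 0 := by
  refine Finset.sum_eq_zero fun r _ => Finset.sum_eq_zero fun p hp => ?_
  exfalso
  rw [Finset.mem_filter, Finset.mem_product, Finset.mem_Ioc, Finset.mem_Ioc] at hp
  obtain ⟨⟨⟨_, h2⟩, ⟨h3, _⟩⟩, hw, _⟩ := hp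
  have hq0 : 0 < q := by omega
  have hdiv : (2 * M - r) / q < 2 := by
    rw [Nat.div_lt_iff_lt_mul hq0]
    omega
  have h1 : p.1 ≤ 1 := by omega
  have h2' : 1 ≤ p.2 := Nat.lt_of_le_of_lt (Nat.zero_le _) h3
  have h1z : (p.1 : ℤ) ≤ 1 := by exact_mod_cast h1
  have h2z : (1 : ℤ) ≤ (p.2 : ℤ) := by exact_mod_cast h2'
  have hQ : (0 : ℤ) ≤ (Nat.sqrt M : ℤ) := by positivity
  linarith

/-- **The crux implies the fan-window coset law (stub 3 of line `SketchIdeator1`) at every `δ`.**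
If `|R_k| ≤ C·M^{3/4+ϑ}` for all `k ≠ 0` (the route declaration `FanDecorrelation`), then for all
moduli `q` with `M^{1/2−δ} ≤ q < 2Q` the class-summed unit fans satisfy
`|Σ_{r<q} U_r(q)| ≤ max(C,0)·M^{3/4+ϑ}` with the SAME `ϑ < 1/4`: for `1 ≤ q ≤ M` the class sum is
`R_q` by residue splitting (`ResidueSplitting.stub_residueSplitting`), and for `q = 0` or `q > M`
it is empty (`classSum_eq_zero_of_lt`).  Together with the skeleton's composition this makes stub 3
EQUIVALENT to the crux restricted to `k ∈ [M^{1/2−δ}, 2Q)`. [folklore] -/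
theorem fanWindowCosetLaw_of_fanDecorrelation (δ : ℝ) (hF : FanDecorrelation) :
    ∀ c : ℤ, c ≠ 0 → ∃ ϑ : ℝ, ϑ < 1 / 4 ∧ ∃ C : ℝ, ∀ M n n' q : ℕ,
      1 ≤ n → 1 ≤ n' → n ≠ n' → n ≤ 2 * M → n' ≤ 2 * M →
        (M : ℝ) ^ (1 / 2 - δ) ≤ q → q < 2 * (Nat.sqrt M + 1) →
          |∑ r ∈ Finset.range q,
              ∑ p ∈ (Finset.Ioc ((M - r) / q) ((2 * M - r) / q) ×ˢ
                      Finset.Ioc ((M - r) / q) ((2 * M - r) / q)).filter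
                  (fun p : ℕ × ℕ => (Nat.sqrt M : ℤ) + 1 ≤ (p.1 : ℤ) - p.2 ∧
                    (p.1 : ℤ) - p.2 < 2 * ((Nat.sqrt M : ℤ) + 1)),
                (liouville (Int.toNat (((q : ℤ) * p.1 + r) * n + c)) : ℝ) *
                  (liouville (Int.toNat (((q : ℤ) * p.2 + r) * n' + c)) : ℝ)| ≤
            C * (M : ℝ) ^ (3 / 4 + ϑ) := by
  intro c hc
  obtain ⟨ϑ, hϑ, C, hC⟩ := hF c hc
  refine ⟨ϑ, hϑ, max C 0, ?_⟩
  intro M n n' q hn hn' hne hnM hn'M _ _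
  have hpow : 0 ≤ (M : ℝ) ^ (3 / 4 + ϑ) := by positivity
  rcases Nat.eq_zero_or_pos q with hq0 | hq0
  · -- `q = 0`: the class sum is empty
    subst hq0
    rw [Finset.sum_range_zero, abs_zero]
    exact mul_nonneg (le_max_right _ _) hpow
  rcases le_or_gt q M with hqM | hqM
  · -- `1 ≤ q ≤ M`: residue splitting read backwards, then the crux at `k = q`
    rw [← ResidueSplitting.stub_residueSplitting c n n' M q hq0 hqM]
    have hk : (q : ℤ) ≠ 0 := by exact_mod_cast (show q ≠ 0 by omega)
    calc _ ≤ C * (M : ℝ) ^ (3 / 4 + ϑ) := hC M n n' (q : ℤ) hn hn' hne hnM hn'M hk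
      _ ≤ max C 0 * (M : ℝ) ^ (3 / 4 + ϑ) := mul_le_mul_of_nonneg_right (le_max_left _ _) hpow
  · -- `q > M`: the class boxes sit inside `{1}`, the lag window is empty
    rw [classSum_eq_zero_of_lt c n n' M q hqM, abs_zero]
    exact mul_nonneg (le_max_right _ _) hpow

/-- **The lag-window law (stub 2 of line `SketchIdeator1`) at any `δ ≤ 1/2` implies the crux at
`k = 1`.**  Its instance `(k, r) = (1, 0)` is a bound `C·M^{1−κ}` for the single unit fan `U_0(1)`,
which by residue splitting at `k = 1` (`ResidueSplitting.stub_residueSplitting`) IS the fan sum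
`R_1`; and `M^{1−κ} = M^{3/4+ϑ}` with `ϑ = 1/4 − κ < 1/4`.  So the open stub contains verbatim the
`k = 1` case of `FanDecorrelation` — the case carrying the whole difficulty of the crux. [folklore] -/
theorem fanDecorrelation_one_of_lagWindowLaw (δ : ℝ) (hδ : δ ≤ 1 / 2)
    (hL : ∀ c : ℤ, c ≠ 0 → ∃ κ : ℝ, 0 < κ ∧ ∃ C : ℝ, ∀ M n n' k r : ℕ,
      1 ≤ n → 1 ≤ n' → n ≠ n' → n ≤ 2 * M → n' ≤ 2 * M → 1 ≤ k →
        (k : ℝ) ≤ (M : ℝ) ^ (1 / 2 - δ) → r < k →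
          |∑ p ∈ (Finset.Ioc ((M - r) / k) ((2 * M - r) / k) ×ˢ
                  Finset.Ioc ((M - r) / k) ((2 * M - r) / k)).filter
              (fun p : ℕ × ℕ => (Nat.sqrt M : ℤ) + 1 ≤ (p.1 : ℤ) - p.2 ∧
                (p.1 : ℤ) - p.2 < 2 * ((Nat.sqrt M : ℤ) + 1)),
            (liouville (Int.toNat (((k : ℤ) * p.1 + r) * n + c)) : ℝ) *
              (liouville (Int.toNat (((k : ℤ) * p.2 + r) * n' + c)) : ℝ)| ≤
            C * (M : ℝ) ^ (1 - κ) / k) :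
    ∀ c : ℤ, c ≠ 0 → ∃ ϑ : ℝ, ϑ < 1 / 4 ∧ ∃ C : ℝ, ∀ M n n' : ℕ,
      1 ≤ n → 1 ≤ n' → n ≠ n' → n ≤ 2 * M → n' ≤ 2 * M →
        |∑ j ∈ Finset.Ico (Nat.sqrt M + 1) (2 * (Nat.sqrt M + 1)),
            ∑ p ∈ (Finset.Ioc M (2 * M) ×ˢ Finset.Ioc M (2 * M)).filter
                (fun p : ℕ × ℕ => (p.1 : ℤ) - p.2 = 1 * (j : ℤ)),
              (liouville (Int.toNat ((p.1 : ℤ) * n + c)) : ℝ) *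
                (liouville (Int.toNat ((p.2 : ℤ) * n' + c)) : ℝ)| ≤
          C * (M : ℝ) ^ (3 / 4 + ϑ) := by
  intro c hc
  obtain ⟨κ, hκ, C, hC⟩ := hL c hc
  refine ⟨1 / 4 - κ, by linarith, C, ?_⟩
  intro M n n' hn hn' hne hnM hn'M
  have hM1 : 1 ≤ M := by omega
  have hM1r : (1 : ℝ) ≤ (M : ℝ) := by exact_mod_cast hM1
  -- the instance `(k, r) = (1, 0)` of the law
  have hk1 : ((1 : ℕ) : ℝ) ≤ (M : ℝ) ^ (1 / 2 - δ) := by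
    rw [Nat.cast_one]
    exact Real.one_le_rpow hM1r (by linarith)
  have key := hC M n n' 1 0 hn hn' hne hnM hn'M le_rfl hk1 zero_lt_one
  -- residue splitting at `k = 1`: `R_1 = U_0(1)`
  have hRS := ResidueSplitting.stub_residueSplitting c n n' M 1 le_rfl hM1
  rw [Finset.sum_range_one] at hRS
  rw [← hRS] at key
  simp only [Nat.cast_one, div_one] at key
  have hexp : (M : ℝ) ^ (1 - κ) = (M : ℝ) ^ (3 / 4 + (1 / 4 - κ)) := by
    congr 1; ring
  rw [hexp] at key
  exact key

end Summit.Parity.GeneralizedHardyLittlewood.Theorems.FanDecorrelation.Circularity
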